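import Literature.NumberTheory.LFunctions.WeilFirstPrimeCertificateCRows1x0
import Literature.NumberTheory.LFunctions.WeilFirstPrimeCertificateCRows1x1
import Literature.NumberTheory.LFunctions.WeilFirstPrimeCertificateCRows1x2
import Literature.NumberTheory.LFunctions.WeilFirstPrimeCertificateCRows1x3
import Literature.NumberTheory.LFunctions.WeilFirstPrimeCertificateCRows1x4
import Literature.NumberTheory.LFunctions.WeilFirstPrimeCertificateCRows1x5
import Literature.NumberTheory.LFunctions.WeilFirstPrimeCertificateCRows1x6
import Literature.NumberTheory.LFunctions.WeilFirstPrimeCertificateCRows1x7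
import Literature.NumberTheory.LFunctions.WeilFirstPrimeCertificateCRows1x8
import Literature.NumberTheory.LFunctions.WeilFirstPrimeCertificateCRows1x9
import Literature.NumberTheory.LFunctions.WeilFirstPrimeCertificateCRows1x10
import Literature.NumberTheory.LFunctions.WeilFirstPrimeCertificateCRows1x11
import Literature.NumberTheory.LFunctions.WeilFirstPrimeCertificateCRows1x12
import Literature.NumberTheory.LFunctions.WeilFirstPrimeCertificateCRows1x13
import Literature.NumberTheory.LFunctions.WeilFirstPrimeCertificateCRows1x14
import Literature.NumberTheory.LFunctions.WeilFirstPrimeCertificateCRows1x15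
import Literature.NumberTheory.LFunctions.WeilFirstPrimeCertificateCRows1x16
import Literature.NumberTheory.LFunctions.WeilFirstPrimeCertificateCKappa
import Literature.NumberTheory.LFunctions.WeilBlockRows
import HarnessLib

/-!
# First-prime Weil positivity, stage C: the parity block `Block1` from its rows

`weilCert3C.base.checkBlockK … 1 = true` assembled from the row-wise kernel checks
(`WeilCert.checkBlockK_of_rows`, `WeilBlockRows.lean`). Pure proof file; nothing is asserted.
-/

noncomputable section

namespace Literature.NumberTheory.LFunctions

/-- **The parity-1 block check** (`D C = I`, `S' − UᵀU` diagonally dominant) of the stage-C first-prime certificate, assembled from its kernel-checked rows (`WeilCert.checkBlockK_of_rows`). [folklore] -/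
theorem checkBlock1_weilCert3C : weilCert3C.base.checkBlockK weilCert3C.nuTab weilCert3C.kappaQ 1 = true := by
  rw [nuTab_weilCert3C, kappaQ_weilCert3C]
  refine WeilCert.checkBlockK_of_rows (fun i hi ↦ ?_) (fun i hi ↦ ?_)
  · have hi' : i < 50 := hi
    interval_cases i
    · exact checkDCRow1_0_weilCert3C
    · exact checkDCRow1_1_weilCert3C
    · exact checkDCRow1_2_weilCert3C
    · exact checkDCRow1_3_weilCert3C
    · exact checkDCRow1_4_weilCert3C
    · exact checkDCRow1_5_weilCert3C
    · exact checkDCRow1_6_weilCert3C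
    · exact checkDCRow1_7_weilCert3C
    · exact checkDCRow1_8_weilCert3C
    · exact checkDCRow1_9_weilCert3C
    · exact checkDCRow1_10_weilCert3C
    · exact checkDCRow1_11_weilCert3C
    · exact checkDCRow1_12_weilCert3C
    · exact checkDCRow1_13_weilCert3C
    · exact checkDCRow1_14_weilCert3C
    · exact checkDCRow1_15_weilCert3C
    · exact checkDCRow1_16_weilCert3C
    · exact checkDCRow1_17_weilCert3C
    · exact checkDCRow1_18_weilCert3C
    · exact checkDCRow1_19_weilCert3C
    · exact checkDCRow1_20_weilCert3C
    · exact checkDCRow1_21_weilCert3C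
    · exact checkDCRow1_22_weilCert3C
    · exact checkDCRow1_23_weilCert3C
    · exact checkDCRow1_24_weilCert3C
    · exact checkDCRow1_25_weilCert3C
    · exact checkDCRow1_26_weilCert3C
    · exact checkDCRow1_27_weilCert3C
    · exact checkDCRow1_28_weilCert3C
    · exact checkDCRow1_29_weilCert3C
    · exact checkDCRow1_30_weilCert3C
    · exact checkDCRow1_31_weilCert3C
    · exact checkDCRow1_32_weilCert3C
    · exact checkDCRow1_33_weilCert3C
    · exact checkDCRow1_34_weilCert3C
    · exact checkDCRow1_35_weilCert3C
    · exact checkDCRow1_36_weilCert3C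
    · exact checkDCRow1_37_weilCert3C
    · exact checkDCRow1_38_weilCert3C
    · exact checkDCRow1_39_weilCert3C
    · exact checkDCRow1_40_weilCert3C
    · exact checkDCRow1_41_weilCert3C
    · exact checkDCRow1_42_weilCert3C
    · exact checkDCRow1_43_weilCert3C
    · exact checkDCRow1_44_weilCert3C
    · exact checkDCRow1_45_weilCert3C
    · exact checkDCRow1_46_weilCert3C
    · exact checkDCRow1_47_weilCert3C
    · exact checkDCRow1_48_weilCert3C
    · exact checkDCRow1_49_weilCert3C
  · have hi' : i < 50 := hi
    interval_cases i
    · exact checkDomRow1_0_weilCert3C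
    · exact checkDomRow1_1_weilCert3C
    · exact checkDomRow1_2_weilCert3C
    · exact checkDomRow1_3_weilCert3C
    · exact checkDomRow1_4_weilCert3C
    · exact checkDomRow1_5_weilCert3C
    · exact checkDomRow1_6_weilCert3C
    · exact checkDomRow1_7_weilCert3C
    · exact checkDomRow1_8_weilCert3C
    · exact checkDomRow1_9_weilCert3C
    · exact checkDomRow1_10_weilCert3C
    · exact checkDomRow1_11_weilCert3C
    · exact checkDomRow1_12_weilCert3C
    · exact checkDomRow1_13_weilCert3C
    · exact checkDomRow1_14_weilCert3C
    · exact checkDomRow1_15_weilCert3C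
    · exact checkDomRow1_16_weilCert3C
    · exact checkDomRow1_17_weilCert3C
    · exact checkDomRow1_18_weilCert3C
    · exact checkDomRow1_19_weilCert3C
    · exact checkDomRow1_20_weilCert3C
    · exact checkDomRow1_21_weilCert3C
    · exact checkDomRow1_22_weilCert3C
    · exact checkDomRow1_23_weilCert3C
    · exact checkDomRow1_24_weilCert3C
    · exact checkDomRow1_25_weilCert3C
    · exact checkDomRow1_26_weilCert3C
    · exact checkDomRow1_27_weilCert3C
    · exact checkDomRow1_28_weilCert3C
    · exact checkDomRow1_29_weilCert3C
    · exact checkDomRow1_30_weilCert3C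
    · exact checkDomRow1_31_weilCert3C
    · exact checkDomRow1_32_weilCert3C
    · exact checkDomRow1_33_weilCert3C
    · exact checkDomRow1_34_weilCert3C
    · exact checkDomRow1_35_weilCert3C
    · exact checkDomRow1_36_weilCert3C
    · exact checkDomRow1_37_weilCert3C
    · exact checkDomRow1_38_weilCert3C
    · exact checkDomRow1_39_weilCert3C
    · exact checkDomRow1_40_weilCert3C
    · exact checkDomRow1_41_weilCert3C
    · exact checkDomRow1_42_weilCert3C
    · exact checkDomRow1_43_weilCert3C
    · exact checkDomRow1_44_weilCert3C
    · exact checkDomRow1_45_weilCert3C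
    · exact checkDomRow1_46_weilCert3C
    · exact checkDomRow1_47_weilCert3C
    · exact checkDomRow1_48_weilCert3C
    · exact checkDomRow1_49_weilCert3C

end Literature.NumberTheory.LFunctions
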